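import Summits.AtomisticToContinuum.Crystallization.Theses.ReggeStarCoercivity
import Literature.MathematicalPhysics.StatisticalMechanics.LennardJonesClusters

/-!
# drefute evidence — the three load-bearing inputs of STUB 1 `stub_closestPairDeletion` (line `separation-padding-transfer`,
crux `ReggeStarCoercivity.StarCoercivity`, stmt-AtomisticToContinuum-13600), kernel-checked

The stub's constants `56` and `1/3` rest on exactly three facts; everything else in its intended proof is `Fin.succAbove`
bookkeeping.  All three are proved here (sorry-free), which is the refuter's certificate that the stub is correctly STATED:

1. `dist_ge_of_starGood` — a STAR-GOOD site is `171/200 = (9/10)(19/20)`-separated from every other particle of its `6/5`-ball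
   (a matched shell point is within `1/20` of a unit vector after rescaling by `a⁻¹`, `a ≥ 9/10`).
2. `card_le_55` — at most `55` points with pairwise distances `≥ 171/200` fit in a closed ball of radius `6/5`
   (`card_le_of_separated_of_dist_le`: `(2·(6/5)/(171/200) + 1)³ = 55.18…`), so deleting one particle flips at most `1 + 55 = 56`
   defect flags — the `56` of the cap `min g (−e_per/56)`.
3. `siteEnergy_pos_of_closest` — at a closest pair of distance `r < 1/3` the site energy is POSITIVE
   (`sum_inv_pow_six_le`: `𝓔^{i₀} ≥ r⁻¹²/12 − (250/6) r⁻⁶ > 0` as `r⁻⁶ > 729 > 500`), so deletion never raises the energy bound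
   to be proved: `E(x) = E(x ∖ i₀) + 𝓔^{i₀}(x) > E(x ∖ i₀)`.
-/

noncomputable section

open scoped BigOperators Classical
open Literature.MathematicalPhysics.StatisticalMechanics Literature.Geometry.DiscreteGeometry

namespace Summit.AtomisticToContinuum.Crystallization.Cruxes.StarCoercivity.SeparationPaddingTransfer.Drefute

/-- Euclidean `3`-space. -/
local notation "E3" => EuclideanSpace ℝ (Fin 3)

/-- Points of `A(K)`, `K` a kissing pattern, are unit vectors. -/
theorem norm_eq_one_of_mem_image_kissing {K : Finset E3} (hK : K = fccKissingPattern ∨ K = hcpKissingPattern)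
    (A : E3 →ₗᵢ[ℝ] E3) {p : E3} (hp : p ∈ K.image A) : ‖p‖ = 1 := by
  obtain ⟨v, hv, rfl⟩ := Finset.mem_image.1 hp
  rw [A.norm_map]
  rcases hK with rfl | rfl
  · exact norm_eq_one_of_mem_fccKissingPattern hv
  · exact norm_eq_one_of_mem_hcpKissingPattern hv

/-- **(1) Star-good sites are `171/200`-separated inside their `6/5`-ball.**  If site `j` is star-good (the crux's free-site
predicate, verbatim) and `k ≠ j` lies within `6/5` of `x j`, then `dist (x j) (x k) ≥ 171/200`. -/
theorem dist_ge_of_starGood {N : ℕ} {x : Fin N → E3} {j k : Fin N} (hkj : k ≠ j) (hd : dist (x j) (x k) ≤ 6 / 5)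
    [DecidablePred fun l : Fin N => l ≠ j ∧ dist (x j) (x l) ≤ 6 / 5]
    (hgood : ∃ a : ℝ, 9 / 10 ≤ a ∧ a ≤ 11 / 10 ∧
      (ShellCloseTo (1 / 20) ((Finset.univ.filter fun l : Fin N => l ≠ j ∧ dist (x j) (x l) ≤ 6 / 5).image
          fun l => a⁻¹ • (x l - x j)) fccKissingPattern ∨
        ShellCloseTo (1 / 20) ((Finset.univ.filter fun l : Fin N => l ≠ j ∧ dist (x j) (x l) ≤ 6 / 5).image
          fun l => a⁻¹ • (x l - x j)) hcpKissingPattern)) :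
    171 / 200 ≤ dist (x j) (x k) := by
  obtain ⟨a, ha1, ha2, hclose⟩ := hgood
  have ha0 : 0 < a := by linarith
  -- one lemma for both patterns
  have key : ∀ K : Finset E3, (K = fccKissingPattern ∨ K = hcpKissingPattern) →
      ShellCloseTo (1 / 20) ((Finset.univ.filter fun l : Fin N => l ≠ j ∧ dist (x j) (x l) ≤ 6 / 5).image
        fun l => a⁻¹ • (x l - x j)) K → 171 / 200 ≤ dist (x j) (x k) := by
    intro K hK ⟨A, e, he⟩
    have hmem : a⁻¹ • (x k - x j) ∈ (Finset.univ.filter fun l : Fin N => l ≠ j ∧ dist (x j) (x l) ≤ 6 / 5).image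
        fun l => a⁻¹ • (x l - x j) :=
      Finset.mem_image_of_mem _ (Finset.mem_filter.2 ⟨Finset.mem_univ _, hkj, hd⟩)
    have h1 := he ⟨_, hmem⟩
    have hp : ‖((e ⟨_, hmem⟩ : ↥(K.image A)) : E3)‖ = 1 := norm_eq_one_of_mem_image_kissing hK A (e ⟨_, hmem⟩).2
    -- ‖t‖ ≥ ‖p‖ - dist t p ≥ 1 - 1/20
    have h2 : (19 / 20 : ℝ) ≤ ‖a⁻¹ • (x k - x j)‖ := by
      have := norm_sub_norm_le ((e ⟨_, hmem⟩ : ↥(K.image A)) : E3) (a⁻¹ • (x k - x j))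
      rw [hp, ← dist_eq_norm, dist_comm] at this
      have h1' : dist (a⁻¹ • (x k - x j)) ((e ⟨_, hmem⟩ : ↥(K.image A)) : E3) ≤ 1 / 20 := h1
      linarith
    rw [norm_smul, norm_inv, Real.norm_of_nonneg ha0.le, ← dist_eq_norm, dist_comm] at h2
    rw [le_inv_mul_iff₀ ha0] at h2
    nlinarith
  rcases hclose with h | h
  · exact key _ (Or.inl rfl) h
  · exact key _ (Or.inr rfl) h

/-- **(2) The packing count behind `56`.**  At most `55` points with pairwise distances `≥ 171/200` lie in a closed ball of
radius `6/5` of `ℝ³`. -/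
theorem card_le_55 (s : Finset E3) (p : E3) (hs : ∀ c ∈ s, dist c p ≤ 6 / 5)
    (hsep : ∀ c ∈ s, ∀ d ∈ s, c ≠ d → (171 / 200 : ℝ) ≤ dist c d) : s.card ≤ 55 := by
  have h := card_le_of_separated_of_dist_le s p (by norm_num : (0 : ℝ) < 171 / 200) (by norm_num : (0 : ℝ) ≤ 6 / 5) hs hsep
  rw [finrank_euclideanSpace, Fintype.card_fin] at h
  have h56 : (s.card : ℝ) < 56 := lt_of_le_of_lt h (by norm_num)
  exact Nat.lt_succ_iff.1 (by exact_mod_cast h56)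

/-- **(3) Positive site energy at a closest pair.**  If all mutual distances are `≥ r`, `0 < r < 1/3`, and `r` is attained
at `(i₀, j₀)`, then `𝓔^{i₀}(x) > 0` (so `E(x) = E(x ∖ i₀) + 𝓔^{i₀}(x) > E(x ∖ i₀)`). The tree's argument inside
`LennardJonesMinimalDistance_holds`, with the ground-state input replaced by the conclusion. -/
theorem siteEnergy_pos_of_closest {N : ℕ} (x : Fin N → E3) {r : ℝ} (hr : 0 < r) (hr3 : r < 1 / 3)
    (hsep : ∀ k l : Fin N, k ≠ l → r ≤ dist (x k) (x l)) {i₀ j₀ : Fin N} (hij : i₀ ≠ j₀)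
    (hrd : dist (x i₀) (x j₀) = r) : 0 < siteEnergy lennardJones x i₀ := by
  have hS := sum_inv_pow_six_le x hr hsep i₀
  have h12 : r⁻¹ ^ 12 ≤ ∑ k ∈ Finset.univ.erase i₀, (dist (x i₀) (x k))⁻¹ ^ 12 := by
    have hj : j₀ ∈ Finset.univ.erase i₀ := Finset.mem_erase.2 ⟨hij.symm, Finset.mem_univ _⟩
    have := Finset.single_le_sum (f := fun k => (dist (x i₀) (x k))⁻¹ ^ 12) (fun k _ => by positivity) hj
    simpa [hrd] using this
  have hexp : siteEnergy lennardJones x i₀ =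
      (1 / 12) * ∑ k ∈ Finset.univ.erase i₀, (dist (x i₀) (x k))⁻¹ ^ 12 -
        (1 / 6) * ∑ k ∈ Finset.univ.erase i₀, (dist (x i₀) (x k))⁻¹ ^ 6 := by
    simp only [siteEnergy, lennardJones, Finset.sum_sub_distrib, Finset.mul_sum]
  have hu : (729 : ℝ) < r⁻¹ ^ 6 := by
    have h3 : 3 < r⁻¹ := by
      rw [lt_inv_comm₀ (by norm_num) hr]
      have : (3 : ℝ)⁻¹ = 1 / 3 := by norm_num
      linarith
    calc (729 : ℝ) = 3 ^ 6 := by norm_num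
      _ < r⁻¹ ^ 6 := pow_lt_pow_left₀ h3 (by norm_num) (by norm_num)
  have h12' : r⁻¹ ^ 12 = (r⁻¹ ^ 6) ^ 2 := by ring
  have hu' : 729 * r⁻¹ ^ 6 < r⁻¹ ^ 6 * r⁻¹ ^ 6 := mul_lt_mul_of_pos_right hu (by linarith)
  rw [h12', sq] at h12
  rw [hexp]
  nlinarith

/-- Sanity: the cap of the stub is consistent — `56 · (−e_per/56) = −e_per` and `1 + 55 = 56`. -/
example : (1 : ℕ) + 55 = 56 := rfl

end Summit.AtomisticToContinuum.Crystallization.Cruxes.StarCoercivity.SeparationPaddingTransfer.Drefute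

end
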